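import Literature.Analysis.FluidPDE.SpaceTimeRescaling
import Literature.Analysis.FluidPDE.NSLerayBlowupRateTopHolds
import Literature.Analysis.FluidPDE.NSWave0

/-!
# The collapse window `2/5 ≤ b ≤ 1/2` for a point singularity of bounded energy

Solo seat `solo-NavierStokesRegularity-informed` (new mathematics *about the summit statement*:
typed constraints on any counterexample, not a substitute theorem). A putative first singularity of
a Clay solution at `(T, x₀)` is probed by the **collapse rescaling at rate `b`**,
`U_t(y) = (T - t)^{1-b} u(t, x₀ + (T - t)^b y)` (`collapseRescale`): the family of zooms in which a
velocity of size `(T - t)^{b-1}` on the length scale `(T - t)^b` is normalised to size one (Leray's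
self-similar ansatz is `b = 1/2`; Chae's "`α`-asymptotically self-similar" scenario is
`b = 1/(1+α)`). Two elementary facts pin the admissible rates to the window `[2/5, 1/2]`:

* `lintegral_collapseRescale_enorm_sq`: the exact energy bookkeeping
  `∫ |U_t|² dy = (T - t)^{2(1-b) - b n} ∫ |u(t)|² dx` on `ℝⁿ`;
* `two_le_collapseRate_mul_of_energyRetained`: if `u` has bounded energy near `T` and the zooms
  `U_t` retain energy `≥ m > 0` in some fixed region as `t → T⁻`, then `(n + 2) b ≥ 2` — on `ℝ³`,
  `b ≥ 2/5` (`twoFifths_le_collapseRate`); this is the time-dependent form of the remark of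
  Chae–Shvydkoy (finite energy excludes `α > N/2` for `α`-asymptotically self-similar blow-up,
  [cite: ChaeShvydkoy2013, p. 3 and Thm. 3.1]) and of the energy-measure dimension count
  `D = N - 2α` of Bronzi–Shvydkoy [cite: BronziShvydkoy2015, Thm. 1.1, Rmk. 1.2];
* `collapseRate_le_half`: if the velocity of a maximal smooth Leray–Hopf solution blows up at `T`
  no faster than `‖u(t)‖_∞ ≤ K (T - t)^{b-1}`, then `b ≤ 1/2` — Leray's lower bound
  `‖u(t)‖_∞ ≥ c √ν (T - t)^{-1/2}` (in tree, discharged: `leray_blowup_rate_top_holds`,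
  [cite: Leray1934, §19 (3.9) p. 224]) read as an exponent inequality.

So a bounded-energy point collapse carrying a definite profile lives in `2/5 ≤ b ≤ 1/2`: at the
Leray end `b = 1/2` the zooms lose all their energy (`∫ |U_t|² = (T - t)^{1/2} ∫ |u(t)|² → 0`), at
the energy end `b = 2/5` they may keep it, and the velocity amplitude is then `(T - t)^{-3/5}`,
strictly above Leray's floor `(T - t)^{-1/2}` — a Type II rate (the self-similar, Type I rate is
`b = 1/2` only). These are the two endpoints of the schema in the seat's sharpest statement, §3;
both inequalities are elementary, the content is that they are now hypotheses-explicit and typed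
over the tree's `HasBoundedEnergy`, `IsMaximalSmoothSolution`, `IsLerayHopfOn`.
-/

noncomputable section

open scoped ENNReal NNReal Topology
open MeasureTheory Set Function Filter Module

namespace Summit.NavierStokesRegularity.NavierStokesRegularity.Theorems

open Literature.Analysis.FluidPDE

section Rescale

variable {E : Type*} [NormedAddCommGroup E] [InnerProductSpace ℝ E]
  {F : Type*} [NormedAddCommGroup F] [NormedSpace ℝ F]

/-- The **collapse rescaling at rate `b`** about the space-time point `(T, x₀)`:
`collapseRescale T x₀ b u t y = (T - t)^{1-b} • u t (x₀ + (T - t)^b • y)`. For `b = 1/2` this is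
Leray's self-similar zoom; a field `u(t, x) = (T - t)^{b-1} U((x - x₀)/(T - t)^b)` has constant
zooms `U`. [folklore] -/
def collapseRescale (T : ℝ) (x₀ : E) (b : ℝ) (u : ℝ → E → F) (t : ℝ) (y : E) : F :=
  (T - t) ^ (1 - b) • u t (x₀ + (T - t) ^ b • y)

/-- Unfolding lemma for `collapseRescale`. [folklore] -/
theorem collapseRescale_apply (T : ℝ) (x₀ : E) (b : ℝ) (u : ℝ → E → F) (t : ℝ) (y : E) :
    collapseRescale T x₀ b u t y = (T - t) ^ (1 - b) • u t (x₀ + (T - t) ^ b • y) := rfl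

/-- Exponent bookkeeping: `((a^{1-b})²) · ((a^b)^n)⁻¹ = a^{2(1-b) - b n}` for `a > 0`. [folklore] -/
private theorem rpow_sq_mul_inv_rpow_pow {a : ℝ} (ha : 0 < a) (b : ℝ) (n : ℕ) :
    (a ^ (1 - b)) ^ 2 * ((a ^ b) ^ n)⁻¹ = a ^ (2 * (1 - b) - b * n) := by
  rw [← Real.rpow_natCast (a ^ (1 - b)) 2, ← Real.rpow_natCast (a ^ b) n,
    ← Real.rpow_mul ha.le, ← Real.rpow_mul ha.le, ← Real.rpow_neg ha.le, ← Real.rpow_add ha]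
  congr 1
  push_cast
  ring

/-- `(T - t)^e → 0` as `t → T⁻`, for `e > 0`. [folklore] -/
private theorem tendsto_rpow_sub_nhdsLT (T : ℝ) {e : ℝ} (he : 0 < e) :
    Tendsto (fun t : ℝ => (T - t) ^ e) (𝓝[<] T) (𝓝 0) := by
  have h0 : Tendsto (fun t : ℝ => T - t) (𝓝[<] T) (𝓝 0) := by
    have h : Tendsto (fun t : ℝ => T - t) (𝓝 T) (𝓝 (T - T)) :=
      ((continuous_const.sub continuous_id).tendsto T)
    rw [sub_self] at h
    exact h.mono_left nhdsWithin_le_nhds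
  have hc : ContinuousAt (fun a : ℝ => a ^ e) 0 := Real.continuousAt_rpow_const 0 e (Or.inr he.le)
  have := hc.tendsto.comp h0
  simpa [Function.comp_def, Real.zero_rpow he.ne'] using this

variable [FiniteDimensional ℝ E] [MeasurableSpace E] [BorelSpace E]

/-- **Energy bookkeeping of the collapse zooms.** For `t < T`,
`∫ |U_t(y)|² dy = (T - t)^{2(1-b) - b·n} ∫ |u(t, x)|² dx`, `n = dim E`: amplitude squared
`(T - t)^{2(1-b)}` times the Jacobian `(T - t)^{-b n}` of `y ↦ x₀ + (T - t)^b y`. The exponent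
vanishes exactly at `b = 2/(n+2)` (`= 2/5` on `ℝ³`). [folklore] -/
theorem lintegral_collapseRescale_enorm_sq {T t : ℝ} (ht : t < T) (x₀ : E) (b : ℝ)
    (u : ℝ → E → F) :
    ∫⁻ y, ‖collapseRescale T x₀ b u t y‖ₑ ^ 2 =
      ENNReal.ofReal ((T - t) ^ (2 * (1 - b) - b * finrank ℝ E)) * ∫⁻ x, ‖u t x‖ₑ ^ 2 := by
  have ha : 0 < T - t := sub_pos.2 ht
  have hγ : 0 < (T - t) ^ b := Real.rpow_pos_of_pos ha b
  have key : ∫⁻ y, ‖u t (x₀ + (T - t) ^ b • y)‖ₑ ^ 2 =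
      ENNReal.ofReal (((T - t) ^ b) ^ finrank ℝ E)⁻¹ * ∫⁻ x, ‖u t x‖ₑ ^ 2 :=
    lintegral_comp_space_affine hγ x₀ (fun x => ‖u t x‖ₑ ^ 2)
  simp only [collapseRescale, enorm_smul, mul_pow]
  rw [lintegral_const_mul' _ _ (ENNReal.pow_ne_top enorm_ne_top), key, ← mul_assoc,
    Real.enorm_eq_ofReal (Real.rpow_nonneg ha.le _),
    ← ENNReal.ofReal_pow (Real.rpow_nonneg ha.le _), ← ENNReal.ofReal_mul (sq_nonneg _),
    rpow_sq_mul_inv_rpow_pow ha]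

/-- **Energy retention forces `(n + 2) b ≥ 2`.** Let `u : ℝ → E → F` have energy `≤ C < ∞` for
`t` near `T⁻`, and suppose the collapse zooms at rate `b` about `(T, x₀)` retain a definite amount
of energy in some fixed region `s`: `∫_s |U_t|² ≥ m > 0` for `t` near `T⁻` (as they do when `U_t`
converges in `L²_loc` to a non-zero profile). Then `2 ≤ (n + 2) b`. Proof: by
`lintegral_collapseRescale_enorm_sq`, `m ≤ (T - t)^{2 - (n+2) b} C → 0` if `(n + 2) b < 2`.
Time-dependent form of the finite-energy exclusion of `α > N/2` for `α`-asymptotically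
self-similar blow-up (`b = 1/(1+α)`). [cite: ChaeShvydkoy2013, p. 3 and Thm. 3.1]
[cite: BronziShvydkoy2015, Thm. 1.1, Rmk. 1.2] -/
theorem two_le_collapseRate_mul_of_energyRetained {T : ℝ} {x₀ : E} {b : ℝ} {u : ℝ → E → F}
    {C m : ℝ≥0∞} (hC : C ≠ ⊤) (hE : ∀ᶠ t in 𝓝[<] T, ∫⁻ x, ‖u t x‖ₑ ^ 2 ≤ C) (hm0 : m ≠ 0)
    {s : Set E} (hm : ∀ᶠ t in 𝓝[<] T, m ≤ ∫⁻ y in s, ‖collapseRescale T x₀ b u t y‖ₑ ^ 2) :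
    2 ≤ (finrank ℝ E + 2) * b := by
  by_contra hlt
  set e : ℝ := 2 * (1 - b) - b * finrank ℝ E with he_def
  have he : 0 < e := by
    simp only [he_def]
    linarith
  have h2 : Tendsto (fun t => ENNReal.ofReal ((T - t) ^ e) * C) (𝓝[<] T) (𝓝 0) := by
    have h := ENNReal.tendsto_ofReal (tendsto_rpow_sub_nhdsLT T he)
    rw [ENNReal.ofReal_zero] at h
    simpa using ENNReal.Tendsto.mul_const h (Or.inr hC)
  have h3 : ∀ᶠ t in 𝓝[<] T, ENNReal.ofReal ((T - t) ^ e) * C < m :=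
    (tendsto_order.1 h2).2 m (pos_iff_ne_zero.2 hm0)
  have h4 : ∀ᶠ t in 𝓝[<] T, t < T := eventually_nhdsWithin_of_forall fun t ht => ht
  obtain ⟨t, htE, htm, hlt', htT⟩ := (hE.and (hm.and (h3.and h4))).exists
  have := calc m ≤ ∫⁻ y in s, ‖collapseRescale T x₀ b u t y‖ₑ ^ 2 := htm
    _ ≤ ∫⁻ y, ‖collapseRescale T x₀ b u t y‖ₑ ^ 2 := setLIntegral_le_lintegral _ _
    _ = ENNReal.ofReal ((T - t) ^ e) * ∫⁻ x, ‖u t x‖ₑ ^ 2 :=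
        lintegral_collapseRescale_enorm_sq htT x₀ b u
    _ ≤ ENNReal.ofReal ((T - t) ^ e) * C := by gcongr
    _ < m := hlt'
  exact lt_irrefl _ this

end Rescale

section R3

/-- **On `ℝ³`: bounded energy and energy-retaining zooms force `b ≥ 2/5`.** If `u` has bounded
energy in Fefferman's sense (7) and its collapse zooms at rate `b` about `(T, x₀)`, `T > 0`, retain
energy `≥ m > 0` in a fixed region as `t → T⁻`, then `2/5 ≤ b`: the profile-carrying end of the
collapse window. Equivalently (`b = 1/(1+α)`): `α ≤ 3/2 = N/2`.
[cite: ChaeShvydkoy2013, p. 3 and Thm. 3.1] [cite: BronziShvydkoy2015, Thm. 1.1, Rmk. 1.2] -/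
theorem twoFifths_le_collapseRate {T : ℝ} (hT : 0 < T) {x₀ : EuclideanSpace ℝ (Fin 3)} {b : ℝ}
    {u : ℝ → EuclideanSpace ℝ (Fin 3) → EuclideanSpace ℝ (Fin 3)} (hu : HasBoundedEnergy u)
    {m : ℝ≥0∞} (hm0 : m ≠ 0) {s : Set (EuclideanSpace ℝ (Fin 3))}
    (hm : ∀ᶠ t in 𝓝[<] T, m ≤ ∫⁻ y in s, ‖collapseRescale T x₀ b u t y‖ₑ ^ 2) :
    2 / 5 ≤ b := by
  obtain ⟨C, hC, hCb⟩ := hu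
  have hE : ∀ᶠ t in 𝓝[<] T, ∫⁻ x, ‖u t x‖ₑ ^ 2 ≤ C := by
    filter_upwards [Ioo_mem_nhdsLT hT] with t ht using hCb t ht.1.le
  have h := two_le_collapseRate_mul_of_energyRetained hC.ne hE hm0 hm
  rw [finrank_euclideanSpace_fin] at h
  push_cast at h
  linarith

/-- **On `ℝ³`: Leray's rate forces `b ≤ 1/2`.** Let `(u, p)` be a maximal smooth solution of the
unforced system with viscosity `ν > 0` and lifespan `T > 0`, Leray–Hopf on `[0, T)` and bounded on
every closed sub-strip (the hypotheses of `leray_blowup_rate_top`). If along the blow-up the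
velocity grows no faster than the rate-`b` collapse amplitude, `‖u(t)‖_∞ ≤ K (T - t)^{b-1}` for
`t` near `T⁻`, then `b ≤ 1/2`: Leray's `‖u(t)‖_∞ ≥ c √ν (T - t)^{-1/2}` gives
`c √ν ≤ K (T - t)^{b - 1/2} → 0` otherwise. The Leray end of the collapse window.
[cite: Leray1934, §19 (3.9) p. 224] [cite: OzanskiPooley2018, Cor. 6.25] -/
theorem collapseRate_le_half {ν T : ℝ} (hν : 0 < ν) (hT : 0 < T)
    {u : ℝ → EuclideanSpace ℝ (Fin 3) → EuclideanSpace ℝ (Fin 3)}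
    {p : ℝ → EuclideanSpace ℝ (Fin 3) → ℝ}
    (hmax : IsMaximalSmoothSolution ν 0 u p T) (hLH : IsLerayHopfOn T ν 0 (u 0) u)
    (hbdd : ∀ T' ∈ Ioo 0 T, eLpNorm (uncurry u) ∞ (volume.restrict (Icc 0 T' ×ˢ univ)) < ∞)
    {K b : ℝ}
    (hrate : ∀ᶠ t in 𝓝[<] T, eLpNorm (u t) ∞ volume ≤ ENNReal.ofReal (K * (T - t) ^ (b - 1))) :
    b ≤ 1 / 2 := by
  obtain ⟨c, hc, hler⟩ := leray_blowup_rate_top_holds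
  have hlow : ∀ t ∈ Ico 0 T,
      ENNReal.ofReal (c * Real.sqrt ν / Real.sqrt (T - t)) ≤ eLpNorm (u t) ∞ volume :=
    hler ν T hν hT u p hmax hLH hbdd
  by_contra hb
  set e : ℝ := b - 1 / 2 with he_def
  have he : 0 < e := by
    simp only [he_def]
    linarith
  have h2 : Tendsto (fun t => K * (T - t) ^ e) (𝓝[<] T) (𝓝 0) := by
    simpa using (tendsto_rpow_sub_nhdsLT T he).const_mul K
  have h3 : ∀ᶠ t in 𝓝[<] T, K * (T - t) ^ e < c * Real.sqrt ν :=
    (tendsto_order.1 h2).2 _ (mul_pos hc (Real.sqrt_pos.2 hν))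
  have h4 : ∀ᶠ t in 𝓝[<] T, t ∈ Ioo 0 T := Ioo_mem_nhdsLT hT
  obtain ⟨t, ht, hKt, hrt⟩ := (h4.and (h3.and hrate)).exists
  have ha : 0 < T - t := sub_pos.2 ht.2
  have hsq : 0 < Real.sqrt (T - t) := Real.sqrt_pos.2 ha
  have key := (hlow t ⟨ht.1.le, ht.2⟩).trans hrt
  rw [ENNReal.ofReal_le_ofReal_iff'] at key
  have hpos : 0 < c * Real.sqrt ν / Real.sqrt (T - t) :=
    div_pos (mul_pos hc (Real.sqrt_pos.2 hν)) hsq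
  rcases key with key | key
  · have hid : K * (T - t) ^ (b - 1) = K * (T - t) ^ e / Real.sqrt (T - t) := by
      rw [Real.sqrt_eq_rpow, eq_div_iff (Real.rpow_pos_of_pos ha _).ne', mul_assoc,
        ← Real.rpow_add ha]
      congr 2
      simp only [he_def]
      ring
    rw [hid, div_le_div_iff_of_pos_right hsq] at key
    linarith
  · linarith

end R3

end Summit.NavierStokesRegularity.NavierStokesRegularity.Theorems
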